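import Summits.Ventures.PackingBounds.Energy.FivePointThomson
import Summits.Ventures.PackingBounds.Energy.ThreePointEnergyDeficit
import Literature.Geometry.DiscreteGeometry.KissingNumberFourUniqueness
import HarnessLib

/-!
# Thomson's problem for five electrons: every minimiser is a triangular bipyramid (rigidity)

Framing: lottery ticket; floor = certified bounds/negative ranges. Venture `PackingBounds`, cell
`pub-packcert`, energy family E3PT (pub-packcert-energy gen 11).

Complementary slackness for the kernel-checked sharp three-point certificate of
`FivePointThomson.thomson_five_points`: if five unit vectors `C ⊂ ℝ³` attain the minimal Coulomb energy
`Σ_{x≠y} 1/‖x-y‖ = 1 + 6√2 + 2√3`, then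
* every pair is at distance `2`, `√2` or `√3` (equality in the Hermite minorant, whose cofactor `q` is
  strictly positive), i.e. `⟪x,y⟫ ∈ {-1, 0, -1/2}`;
* `Σ_{x∈C} x = 0` (the two-point multiplier `a₁ > 0`, `ThreePointDeficit.sum_eq_zero_of_sharp`);
* by the frame-potential bound `|C|² ≤ 3 Σ⟪x,y⟫²` there is an antipodal pair `±p ∈ C`, the other three
  points are orthogonal to `p` and pairwise at inner product `-1/2`:
`C` is a triangular bipyramid (`thomson_five_points_rigid`). This is the uniqueness part of
R. E. Schwartz's five-electron theorem (Exp. Math. 22 (2013)), here read off the exact SDP certificate.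
-/

noncomputable section

open Finset
open scoped RealInnerProductSpace

namespace Summit.Ventures.PackingBounds.Energy.FivePointThomson

open Literature.Geometry.DiscreteGeometry Literature.Geometry.DiscreteGeometry.BachocVallentin
open Literature.Analysis.SpecialFunctions

/-- The Hermite cofactor is strictly positive on `m ≥ 0` (its constant coefficient is `1/12`). -/
theorem qaux_pos (m : ℝ) (hm : 0 ≤ m) : 0 < qaux m := by
  have q1 : (0:ℝ) ≤ (((-1 : ℝ)/3) + ((65 : ℝ)/24) * s2 + ((-35 : ℝ)/18) * s3 + (0 : ℝ) * (s2 * s3)) :=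
    kval_nonneg _ _ _ _ (by norm_num)
  have q2 : (0:ℝ) ≤ (((31 : ℝ)/24) + ((47 : ℝ)/48) * s2 + ((-11 : ℝ)/9) * s3 + ((-7 : ℝ)/36) * (s2 * s3)) :=
    kval_nonneg _ _ _ _ (by norm_num)
  have q3 : (0:ℝ) ≤ (((1 : ℝ)/3) + ((-7 : ℝ)/8) * s2 + ((37 : ℝ)/36) * s3 + ((-25 : ℝ)/72) * (s2 * s3)) :=
    kval_nonneg _ _ _ _ (by norm_num)
  have q4 : (0:ℝ) ≤ (((1 : ℝ)/8) + ((-9 : ℝ)/16) * s2 + ((7 : ℝ)/18) * s3 + (0 : ℝ) * (s2 * s3)) :=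
    kval_nonneg _ _ _ _ (by norm_num)
  have hq : qaux m = ((1 : ℝ)/12)
      + (((-1 : ℝ)/3) + ((65 : ℝ)/24) * s2 + ((-35 : ℝ)/18) * s3 + (0 : ℝ) * (s2 * s3)) * m
      + (((31 : ℝ)/24) + ((47 : ℝ)/48) * s2 + ((-11 : ℝ)/9) * s3 + ((-7 : ℝ)/36) * (s2 * s3)) * m ^ 2
      + (((1 : ℝ)/3) + ((-7 : ℝ)/8) * s2 + ((37 : ℝ)/36) * s3 + ((-25 : ℝ)/72) * (s2 * s3)) * m ^ 3
      + (((1 : ℝ)/8) + ((-9 : ℝ)/16) * s2 + ((7 : ℝ)/18) * s3 + (0 : ℝ) * (s2 * s3)) * m ^ 4 := by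
    unfold qaux; ring
  rw [hq]
  have h1 := mul_nonneg q1 hm
  have h2 := mul_nonneg q2 (pow_nonneg hm 2)
  have h3 := mul_nonneg q3 (pow_nonneg hm 3)
  have h4 := mul_nonneg q4 (pow_nonneg hm 4)
  linarith

/-- The two-point multiplier is strictly positive (`a₁ ≈ 5.5·10⁻⁴`). -/
theorem a1_pos : 0 < a1K := by
  have h := kval_nonneg (((-1166402848935413533 : ℝ)/71248353479884800) - 1 / 10000) (((-14117 : ℝ)/2700))
    (((83356 : ℝ)/6075)) (0 : ℝ) (by norm_num)
  unfold a1K; linarith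

/-- Equality in the Hermite minorant at distance `m ∈ (0,2]` forces `m ∈ {2, √2, √3}`. -/
theorem dist_of_pmin_eq (m : ℝ) (h0 : 0 < m) (h2 : m ≤ 2) (heq : pminK (1 - m ^ 2 / 2) = 1 / m) :
    m = 2 ∨ m = s2 ∨ m = s3 := by
  have hid := one_sub_mul_pmin m
  have hm1 : m * pminK (1 - m ^ 2 / 2) = 1 := by
    rw [heq]; field_simp
  have hz : (2 - m) * (m - s2) ^ 2 * (m - s3) ^ 2 * qaux m = 0 := by linarith
  have hq := qaux_pos m h0.le
  rcases mul_eq_zero.1 hz with h | h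
  · rcases mul_eq_zero.1 h with h' | h'
    · rcases mul_eq_zero.1 h' with h'' | h''
      · left; linarith
      · right; left; exact sub_eq_zero.1 ((pow_eq_zero_iff two_ne_zero).1 h'')
    · right; right; exact sub_eq_zero.1 ((pow_eq_zero_iff two_ne_zero).1 h')
  · exact absurd h hq.ne'

/-- For distinct unit vectors, equality in the Hermite minorant forces `⟪x,y⟫ ∈ {-1, 0, -1/2}`. -/
theorem inner_of_pmin_eq {x y : EuclideanSpace ℝ (Fin 3)} (hx : ‖x‖ = 1) (hy : ‖y‖ = 1) (hxy : x ≠ y)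
    (heq : pminK (inner ℝ x y) = 1 / ‖x - y‖) :
    inner ℝ x y = -1 ∨ inner ℝ x y = 0 ∨ inner ℝ x y = -1 / 2 := by
  have hnorm : ‖x - y‖ ^ 2 = 2 - 2 * inner ℝ x y := by
    rw [@norm_sub_sq_real, hx, hy]; ring
  have hpos : 0 < ‖x - y‖ := norm_pos_iff.2 (sub_ne_zero.2 hxy)
  have hle : ‖x - y‖ ≤ 2 := by
    calc ‖x - y‖ ≤ ‖x‖ + ‖y‖ := norm_sub_le x y
      _ = 2 := by rw [hx, hy]; norm_num
  have hin : inner ℝ x y = 1 - ‖x - y‖ ^ 2 / 2 := by linarith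
  rw [hin] at heq ⊢
  have hs2 : s2 ^ 2 = 2 := Real.sq_sqrt (by norm_num)
  have hs3 : s3 ^ 2 = 3 := Real.sq_sqrt (by norm_num)
  rcases dist_of_pmin_eq _ hpos hle heq with h | h | h
  · left; rw [h]; norm_num
  · right; left; rw [h, hs2]; norm_num
  · right; right; rw [h, hs3]; norm_num

/-- **Rigidity of the five-electron ground state.** If five unit vectors of `ℝ³` attain the minimal
Coulomb energy `1 + 6√2 + 2√3` (ordered pairs), then all inner products of distinct points lie in
`{-1, 0, -1/2}`, the configuration is balanced (`Σ x = 0`), and it is a triangular bipyramid: there is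
an antipodal pair `±p ∈ C`, every other point is orthogonal to `p`, and any two of the other three
points have inner product `-1/2`. -/
theorem thomson_five_points_rigid (C : Finset (EuclideanSpace ℝ (Fin 3))) (hC : ∀ x ∈ C, ‖x‖ = 1)
    (h5 : C.card = 5)
    (hmin : ∑ x ∈ C, ∑ y ∈ C.erase x, 1 / ‖x - y‖ = 1 + 6 * Real.sqrt 2 + 2 * Real.sqrt 3) :
    (∀ x ∈ C, ∀ y ∈ C, x ≠ y → inner ℝ x y = -1 ∨ inner ℝ x y = 0 ∨ inner ℝ x y = -1 / 2)
    ∧ (∑ x ∈ C, x = 0)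
    ∧ ∃ p ∈ C, -p ∈ C ∧ (∀ z ∈ C, z ≠ p → z ≠ -p → inner ℝ z p = 0)
        ∧ (∀ z ∈ C, ∀ w ∈ C, z ≠ p → z ≠ -p → w ≠ p → w ≠ -p → z ≠ w → inner ℝ z w = -1 / 2) := by
  classical
  -- (0) the certificate inequality and its equality
  have hA := pairSum_gegenbauer_comb_nonneg (n := 3) (by norm_num) 1 acoK aco_nonneg C hC
  have hF := tripleSum_threePointF3_nonneg 4 15 dcoK dco_nonneg gwK C hC
  have hcard : (C.card : ℝ) = 5 := by exact_mod_cast h5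
  have hAeval : ∀ w : ℝ, (∑ k ∈ range (1 + 1), acoK k * gegenbauerSum ((((3 : ℕ) : ℝ) - 2) / 2) k w)
      = a1K * w := by
    intro w
    have h0 : acoK 0 = 0 := rfl
    have h1 : acoK 1 = a1K := rfl
    simp only [Finset.sum_range_succ, Finset.sum_range_zero, h0, h1, gegenbauerSum_one, gegenbauerSum_zero]
    push_cast
    ring
  have hineq : ∀ u v t : ℝ, -1 ≤ u → u < 1 → -1 ≤ v → v < 1 → -1 ≤ t → t < 1 →
      0 ≤ 1 + 2 * u * v * t - u ^ 2 - v ^ 2 - t ^ 2 →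
      c0K + ((C.card : ℝ) - 2) * threePointF3 4 15 dcoK gwK u v t + threePointF3 4 15 dcoK gwK u u 1
        + threePointF3 4 15 dcoK gwK v v 1 + threePointF3 4 15 dcoK gwK t t 1
        + ((fun w => ∑ k ∈ range (1 + 1), acoK k * gegenbauerSum ((((3 : ℕ) : ℝ) - 2) / 2) k w) u
          + (fun w => ∑ k ∈ range (1 + 1), acoK k * gegenbauerSum ((((3 : ℕ) : ℝ) - 2) / 2) k w) v
          + (fun w => ∑ k ∈ range (1 + 1), acoK k * gegenbauerSum ((((3 : ℕ) : ℝ) - 2) / 2) k w) t) / 3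
        ≤ (pminK u + pminK v + pminK t) / 3 := by
    intro u v t hu1 hu2 hv1 hv2 ht1 ht2 hdet
    simp only [hAeval, hcard, threePointF3_eq]
    have h1 := slack_nonneg u v t
    linarith
  have key := CohnWoo.energy_ge_of_threePoint C hC (by omega) pminK _ _ c0K hA hF
    (threePointF3_swap12 4 15 dcoK gwK) (threePointF3_swap23 4 15 dcoK gwK) hineq
  have key' := key
  simp only [hAeval, hcard, threePointF3_eq] at key'
  rw [bound_eq] at key'
  -- pointwise minorant and termwise equality
  have hle : ∀ x ∈ C, ∀ y ∈ C.erase x, pminK (inner ℝ x y) ≤ 1 / ‖x - y‖ := by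
    intro x hx y hy
    have hyC : y ∈ C := Finset.mem_of_mem_erase hy
    have hxy : x ≠ y := fun h => (Finset.ne_of_mem_erase hy) h.symm
    have hnorm : ‖x - y‖ ^ 2 = 2 - 2 * inner ℝ x y := by
      rw [@norm_sub_sq_real, hC x hx, hC y hyC]; ring
    have hpos : 0 < ‖x - y‖ := norm_pos_iff.2 (sub_ne_zero.2 hxy)
    have hle2 : ‖x - y‖ ≤ 2 := by
      calc ‖x - y‖ ≤ ‖x‖ + ‖y‖ := norm_sub_le x y
        _ = 2 := by rw [hC x hx, hC y hyC]; norm_num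
    have hin : inner ℝ x y = 1 - ‖x - y‖ ^ 2 / 2 := by linarith
    rw [hin]
    exact pmin_le _ hpos hle2
  have hs : 1 + 6 * Real.sqrt 2 + 2 * Real.sqrt 3 = 1 + 6 * s2 + 2 * s3 := rfl
  have hsumle : ∑ x ∈ C, ∑ y ∈ C.erase x, pminK (inner ℝ x y) ≤ ∑ x ∈ C, ∑ y ∈ C.erase x, 1 / ‖x - y‖ :=
    Finset.sum_le_sum fun x hx => Finset.sum_le_sum fun y hy => hle x hx y hy
  have hEqP : ∑ x ∈ C, ∑ y ∈ C.erase x, pminK (inner ℝ x y) = 1 + 6 * s2 + 2 * s3 := by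
    apply le_antisymm _ key'
    rw [← hs, ← hmin]; exact hsumle
  have hEq2 : ∑ x ∈ C, ∑ y ∈ C.erase x, pminK (inner ℝ x y) = ∑ x ∈ C, ∑ y ∈ C.erase x, 1 / ‖x - y‖ := by
    rw [hEqP, hmin, hs]
  have hterm : ∀ x ∈ C, ∀ y ∈ C.erase x, pminK (inner ℝ x y) = 1 / ‖x - y‖ := by
    have houter := (Finset.sum_eq_sum_iff_of_le (fun x hx => Finset.sum_le_sum fun y hy => hle x hx y hy)).1 hEq2
    intro x hx
    exact (Finset.sum_eq_sum_iff_of_le (fun y hy => hle x hx y hy)).1 (houter x hx)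
  -- (1) the value set
  have hvals : ∀ x ∈ C, ∀ y ∈ C, x ≠ y → inner ℝ x y = -1 ∨ inner ℝ x y = 0 ∨ inner ℝ x y = -1 / 2 := by
    intro x hx y hy hxy
    have hy' : y ∈ C.erase x := Finset.mem_erase.2 ⟨fun h => hxy h.symm, hy⟩
    exact inner_of_pmin_eq (hC x hx) (hC y hy) hxy (hterm x hx y hy')
  -- (2) balanced: complementary slackness of the two-point part
  have hsharp : ∑ x ∈ C, ∑ y ∈ C.erase x, pminK (inner ℝ x y)
      = (C.card : ℝ) * (((C.card : ℝ) - 1) * c0K - threePointF3 4 15 dcoK gwK 1 1 1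
        - (fun w => ∑ k ∈ range (1 + 1), acoK k * gegenbauerSum ((((3 : ℕ) : ℝ) - 2) / 2) k w) 1) := by
    simp only [hAeval, hcard, threePointF3_eq]
    rw [hEqP, ← bound_eq]
  obtain ⟨hA0, -⟩ := ThreePointDeficit.pairSum_eq_zero_of_sharp C hC (by omega) pminK _ _ c0K hA hF
    (threePointF3_swap12 4 15 dcoK gwK) (threePointF3_swap23 4 15 dcoK gwK) hineq hsharp
  have hfun : (fun w => ∑ k ∈ range (1 + 1), acoK k * gegenbauerSum ((((3 : ℕ) : ℝ) - 2) / 2) k w)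
      = fun t => a1K * t := funext hAeval
  rw [hfun] at hA0
  have hsum0 : ∑ x ∈ C, x = 0 := ThreePointDeficit.sum_eq_zero_of_sharp C a1K a1_pos hA0
  -- row sums
  have hrow : ∀ x ∈ C, ∑ y ∈ C.erase x, inner ℝ x y = -1 := by
    intro x hx
    have htot : ∑ y ∈ C, inner ℝ x y = 0 := by rw [← inner_sum, hsum0, inner_zero_right]
    have hself : inner ℝ x x = (1 : ℝ) := by rw [real_inner_self_eq_norm_sq, hC x hx]; norm_num
    have := Finset.add_sum_erase C (fun y => inner ℝ x y) hx
    rw [htot, hself] at this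
    linarith
  refine ⟨hvals, hsum0, ?_⟩
  -- (3) an antipodal pair exists, by the frame-potential bound
  have hfr := d4u_frame_potential (EuclideanSpace.basisFun (Fin 3) ℝ) C hC
  rw [Fintype.card_fin, hcard] at hfr
  have hanti : ∃ p ∈ C, ∃ y ∈ C, inner ℝ p y = -1 := by
    by_contra hna
    push Not at hna
    have hrow2 : ∀ x ∈ C, ∑ y ∈ C, inner ℝ x y ^ 2 ≤ 3 / 2 := by
      intro x hx
      have hself : inner ℝ x x = (1 : ℝ) := by rw [real_inner_self_eq_norm_sq, hC x hx]; norm_num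
      have hoff : ∑ y ∈ C.erase x, inner ℝ x y ^ 2 ≤ ∑ y ∈ C.erase x, (-(1 / 2 : ℝ)) * inner ℝ x y := by
        refine Finset.sum_le_sum fun y hy => ?_
        have hyC : y ∈ C := Finset.mem_of_mem_erase hy
        have hxy : x ≠ y := fun h => (Finset.ne_of_mem_erase hy) h.symm
        rcases hvals x hx y hyC hxy with h | h | h
        · exact absurd h (hna x hx y hyC)
        · rw [h]; norm_num
        · rw [h]; norm_num
      rw [← Finset.mul_sum, hrow x hx] at hoff
      have := Finset.add_sum_erase C (fun y => inner ℝ x y ^ 2) hx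
      rw [hself] at this
      linarith
    have htot : ∑ x ∈ C, ∑ y ∈ C, inner ℝ x y ^ 2 ≤ 5 * (3 / 2) := by
      calc ∑ x ∈ C, ∑ y ∈ C, inner ℝ x y ^ 2 ≤ ∑ x ∈ C, (3 / 2 : ℝ) := Finset.sum_le_sum hrow2
        _ = 5 * (3 / 2) := by rw [Finset.sum_const, nsmul_eq_mul, h5]; norm_num
    have h3 : ((3 : ℕ) : ℝ) = 3 := by norm_num
    rw [h3] at hfr
    linarith
  obtain ⟨p, hp, y0, hy0, hpy⟩ := hanti
  have hy0eq : y0 = -p := by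
    have := (inner_eq_neg_one_iff_of_norm_eq_one (𝕜 := ℝ) (hC p hp) (hC y0 hy0)).1 hpy
    rw [this, neg_neg]
  have hnp : -p ∈ C := hy0eq ▸ hy0
  have hp0 : p ≠ 0 := by
    intro h; have := hC p hp; rw [h, norm_zero] at this; norm_num at this
  have hpnp : p ≠ -p := fun h => hp0 (by
    have : (2 : ℝ) • p = 0 := by rw [two_smul]; nth_rewrite 2 [h]; exact add_neg_cancel p
    exact (smul_eq_zero.1 this).resolve_left two_ne_zero)
  -- points off the poles are orthogonal to p
  have horth : ∀ z ∈ C, z ≠ p → z ≠ -p → inner ℝ z p = 0 := by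
    intro z hz hzp hznp
    have h1 := hvals z hz p hp hzp
    have h2 := hvals z hz (-p) hnp hznp
    rw [inner_neg_right] at h2
    rcases h1 with a | a | a <;> rcases h2 with b | b | b <;> linarith
  refine ⟨p, hp, hnp, horth, ?_⟩
  -- the equatorial set
  set R : Finset (EuclideanSpace ℝ (Fin 3)) := (C.erase p).erase (-p) with hR
  have hnpC : -p ∈ C.erase p := Finset.mem_erase.2 ⟨fun h => hpnp h.symm, hnp⟩
  have hRcard : R.card = 3 := by
    rw [hR, Finset.card_erase_of_mem hnpC, Finset.card_erase_of_mem hp, h5]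
  have hmemR : ∀ z, z ∈ R ↔ z ∈ C ∧ z ≠ p ∧ z ≠ -p := by
    intro z; rw [hR, Finset.mem_erase, Finset.mem_erase]; tauto
  -- sum over C split along p, -p, z
  have hsplit : ∀ z ∈ R, ∀ g : EuclideanSpace ℝ (Fin 3) → ℝ,
      ∑ y ∈ C, g y = g p + g (-p) + g z + ∑ y ∈ R.erase z, g y := by
    intro z hz g
    rw [← Finset.add_sum_erase C g hp, ← Finset.add_sum_erase (C.erase p) g hnpC, ← hR,
      ← Finset.add_sum_erase R g hz]
    ring
  -- no antipodal pair inside R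
  have hnoanti : ∀ z ∈ R, ∀ w ∈ R, inner ℝ z w ≠ -1 := by
    intro z hz w hw hzw
    obtain ⟨hzC, hzp, hznp⟩ := (hmemR z).1 hz
    obtain ⟨hwC, hwp, hwnp⟩ := (hmemR w).1 hw
    have hweq : w = -z := by
      have := (inner_eq_neg_one_iff_of_norm_eq_one (𝕜 := ℝ) (hC z hzC) (hC w hwC)).1 hzw
      rw [this, neg_neg]
    have hz0 : z ≠ 0 := by
      intro h; have := hC z hzC; rw [h, norm_zero] at this; norm_num at this
    have hzw' : z ≠ w := by
      rw [hweq]; intro h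
      have : (2 : ℝ) • z = 0 := by rw [two_smul]; nth_rewrite 2 [h]; exact add_neg_cancel z
      exact hz0 ((smul_eq_zero.1 this).resolve_left two_ne_zero)
    have hwRz : w ∈ R.erase z := Finset.mem_erase.2 ⟨hzw'.symm, hw⟩
    -- the third point t of R
    have hcard1 : ((R.erase z).erase w).card = 1 := by
      rw [Finset.card_erase_of_mem hwRz, Finset.card_erase_of_mem hz, hRcard]
    obtain ⟨t, ht⟩ := Finset.card_eq_one.1 hcard1
    have htmem : t ∈ (R.erase z).erase w := by rw [ht]; exact Finset.mem_singleton_self t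
    have htRz : t ∈ R.erase z := Finset.mem_of_mem_erase htmem
    have htw : t ≠ w := Finset.ne_of_mem_erase htmem
    have htR : t ∈ R := Finset.mem_of_mem_erase htRz
    have htz : t ≠ z := Finset.ne_of_mem_erase htRz
    obtain ⟨htC, htp, htnp⟩ := (hmemR t).1 htR
    -- ⟪t, z⟫ = 0 by the ± argument
    have htz0 : inner ℝ t z = 0 := by
      have h1 := hvals t htC z hzC htz
      have h2 := hvals t htC w hwC htw
      rw [hweq, inner_neg_right] at h2
      rcases h1 with a | a | a <;> rcases h2 with b | b | b <;> linarith
    -- total row sum of t is 1, contradiction with 0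
    have htot : ∑ y ∈ C, inner ℝ t y = 0 := by rw [← inner_sum, hsum0, inner_zero_right]
    have hself : inner ℝ t t = (1 : ℝ) := by rw [real_inner_self_eq_norm_sq, hC t htC]; norm_num
    have hsp := hsplit z hz (fun y => inner ℝ t y)
    have hrest : ∑ y ∈ R.erase z, inner ℝ t y = inner ℝ t w + ∑ y ∈ (R.erase z).erase w, inner ℝ t y :=
      (Finset.add_sum_erase (R.erase z) (fun y => inner ℝ t y) hwRz).symm
    rw [ht, Finset.sum_singleton] at hrest
    have htp0 : inner ℝ t p = 0 := horth t htC htp htnp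
    have htnp0 : inner ℝ t (-p) = 0 := by rw [inner_neg_right, htp0, neg_zero]
    have htw0 : inner ℝ t w = 0 := by rw [hweq, inner_neg_right, htz0, neg_zero]
    rw [htot, hrest, htp0, htnp0, htz0, htw0, hself] at hsp
    norm_num at hsp
  -- conclusion: equatorial inner products are -1/2
  intro z hzC w hwC hzp hznp hwp hwnp hzw
  have hz : z ∈ R := (hmemR z).2 ⟨hzC, hzp, hznp⟩
  have hw : w ∈ R := (hmemR w).2 ⟨hwC, hwp, hwnp⟩
  have hwRz : w ∈ R.erase z := Finset.mem_erase.2 ⟨fun h => hzw h.symm, hw⟩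
  have hcard1 : ((R.erase z).erase w).card = 1 := by
    rw [Finset.card_erase_of_mem hwRz, Finset.card_erase_of_mem hz, hRcard]
  obtain ⟨t, ht⟩ := Finset.card_eq_one.1 hcard1
  have htmem : t ∈ (R.erase z).erase w := by rw [ht]; exact Finset.mem_singleton_self t
  have htRz : t ∈ R.erase z := Finset.mem_of_mem_erase htmem
  have htR : t ∈ R := Finset.mem_of_mem_erase htRz
  have htz : t ≠ z := Finset.ne_of_mem_erase htRz
  obtain ⟨htC, htp, htnp⟩ := (hmemR t).1 htR
  -- row of z: ⟪z,w⟫ + ⟪z,t⟫ = -1, both in {0, -1/2}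
  have htot : ∑ y ∈ C, inner ℝ z y = 0 := by rw [← inner_sum, hsum0, inner_zero_right]
  have hself : inner ℝ z z = (1 : ℝ) := by rw [real_inner_self_eq_norm_sq, hC z hzC]; norm_num
  have hsp := hsplit z hz (fun y => inner ℝ z y)
  have hrest : ∑ y ∈ R.erase z, inner ℝ z y = inner ℝ z w + ∑ y ∈ (R.erase z).erase w, inner ℝ z y :=
    (Finset.add_sum_erase (R.erase z) (fun y => inner ℝ z y) hwRz).symm
  rw [ht, Finset.sum_singleton] at hrest
  have hzp0 : inner ℝ z p = 0 := horth z hzC hzp hznp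
  have hznp0 : inner ℝ z (-p) = 0 := by rw [inner_neg_right, hzp0, neg_zero]
  rw [htot, hrest, hzp0, hznp0, hself] at hsp
  have h1 := hvals z hzC w hwC hzw
  have h2 := hvals z hzC t htC htz.symm
  have n1 := hnoanti z hz w hw
  have n2 := hnoanti z hz t htR
  rcases h1 with a | a | a
  · exact absurd a n1
  · rcases h2 with b | b | b
    · exact absurd b n2
    · linarith
    · linarith
  · exact a

end Summit.Ventures.PackingBounds.Energy.FivePointThomson
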